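import Literature.MathematicalPhysics.QuantumLattice.HubbardSquareTorusLimitState
import Literature.MathematicalPhysics.QuantumLattice.HubbardAndersonClusterBound
import Summits.Ventures.CertifiedManyBodySolver.Statement
import Summits.HubbardSuperconductivity.ManyBodyBootstrap.Bounds.AndersonRowsSquare
import Literature.LinearAlgebra.Matrix.PosSemidefTrace
import Literature.MathematicalPhysics.QuantumLattice.InfVolFermionStateTorusLimitLocalStability
import Summits.Ventures.CertifiedManyBodySolver.Rows.AndersonDominatedByLTI
import HarnessLib

/-!
# Square-lattice (2-D) window-marginal nodes for the Hubbard thermodynamic-limit energy: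
# `TIStateNode`, `LTIRectNode`, `LTIRectGSNode` (LTI + `S^z` + local-stability/KKT rows), their PROVED transport
# to `energyDensity2D` / `M2`·`M3` rows, the PROVED edge "Anderson cluster floor ⇒ TI-state node", and the PROVED
# dominance "Anderson sub-cluster floor ⇒ LTI rectangle node"

sr-mbsolver **op-07 gen-11** (2026-08-22), input for the hubbard-alg programme, BET-L2 "cluster marginals + SDP
gluing" (L2-cluster/DESIGN.md M4/J4: *type the 2-D LTI node in `tl_marginal2d`'s problem shape; prove the gluing
inequality*).  HOME scratch file — NOT in the tree; written for the LIT lanes (lit-4 / l5-lit-1) to file, e.g. as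
`Summits/Ventures/CertifiedManyBodySolver/Rows/RectMarginalNodes.lean` (rename the namespace
`…CertifiedManyBodySolver.Sketch2D` → `…CertifiedManyBodySolver`; the primed lemmas of §3.1/§3.3 re-derive
file-private lemmas of `HubbardAndersonClusterBound.lean` and may be replaced by making those public).
`lean check` (farm): rc 0, 0 `sorry`, standard axioms.

HONEST FRAMING: first certified bounds; not a superconductivity verdict; every number certified or labelled float.
This file proves SOUNDNESS and DOMINANCE statements (inequalities between relaxations); it certifies no new number.

## What is here (all proved)

* §1 **TI dictionary.** For a translation-invariant state `ω` on `ℤ² × {↑,↓}` and ANY finite region `R`, the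
  expectation of a weighted open-cluster Hamiltonian is read off the weight sums:
  `ω(h_R(J,V,μ)) = Σ_i (Σ_{bonds ∥ e_i} J) h_i(ω) + (Σ V) u(ω) + (Σ μ) ω(n_0)` (`expect_clusterHamiltonian`), with
  `e(ω) = Re (u + h_0 + h_1)` (`hubbardEnergyDensity_eq_re`).
* §2 **`TIStateNode t U n lo`** `:= ∀ ω TI, even, density n → lo ≤ e(ω)`; transport
  `TIStateNode.le_energyDensity2D : … → lo ≤ energyDensity2D t U n` (`0 ≤ n < 2`, `U ≥ 0`; one line over the tree's
  `le_energyDensity2D_of_forall_isTranslationInvariant`); TIGHTNESS `tiStateNode_energyDensity2D` (the node holds at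
  `lo = e(t,U,n)` itself: Gibbs variational principle) — so every complete hierarchy of relaxations of this node
  converges to the TL energy; cells `TIStateNode.m2EnergyLowerRow`, `TIStateNode.m3EnergyLowerRow` (target of record
  `U = 8`, `n = 7/8`, `t' = 0`).
* §3 **EDGE Anderson ⇒ TIStateNode** for every density and every real `U` (pure positivity + the dictionary, using the
  cluster and its transpose): `tiStateNode_of_andersonCluster_transposePair` (general weighted cluster, total bond
  weight 2, site weight 1), `tiStateNode_of_andersonRect` (rectangle tables, the certificate-row form), instance
  `tiStateNode_of_rect2x4rot_opt_U8 : anderson_psd_rect2x4rot_opt_U8 → ∀ n, TIStateNode 1 8 n (q - 4(1-n))`.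
* §4 **`LTIRectNode t U a b n lo`** — the MATRIX-LEVEL node a rounded SDP dual certifies, in the problem shape of
  op-08's `tl_marginal2d` minus its symmetry rows: `∀ ρ : FermionOp ([0,a)×[0,b))` (`4^{ab} × 4^{ab}`), `ρ ⪰ 0`,
  `Tr ρ = 1`, `WindowLTI ρ` (every sub-region marginal equals its in-window translates, pulled back along `Γ(τ_v)`),
  `Re Tr ρ N = ab·n` `→ lo ≤ Re Tr ρ h_avg` (`hAvg` = uniform weights `1/((a-1)b)`, `1/(a(b-1))`, `1/(ab)`).
  SOUNDNESS `LTIRectNode.tiStateNode` (`a, b ≥ 2`; the window marginal `ω.rdm` of a TI state is feasible: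
  `windowLTI_rdm`, `re_expect_hAvg`), hence `LTIRectNode.m3EnergyLowerRow` / `.m2EnergyLowerRow`.
* §5 **DOMINANCE (the gluing inequality, weak form).** Matrix-level dictionary for window-LTI matrices (`wfun`,
  `WindowLTI.wfun_pair/_singleton/_nAt_add`, `WindowLTI.wfun_clusterHamiltonian`, `.wfun_andersonCluster`,
  `.trace_mul_totalNumber`) and: `ltiRectNode_of_andersonCluster_subset` — an Anderson floor `h(R; w, v) ⪰ q` of ANY
  sub-cluster `R ⊆ W` with unit bond weight per direction and unit site weight is a valid inequality of the node,
  `LTIRectNode t U a b n (q - (U/2)(1-n))` (so the LTI optimum is `≥` every such Anderson bound, the bare tiling of the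
  window included); `ltiRectNode_of_andersonRect_subset` (sub-rectangle tables);
  `ltiRectNode_of_andersonCluster_transposePair_subset` (total weight 2 when `R` and `Rᵀ` both fit, e.g. square
  windows); instance `ltiRectNode_of_rect2x4rot_opt_U8 : … → ∀ n, ∀ a ≥ 4, LTIRectNode 1 8 a a n (q - 4(1-n))`.
* §6 **`LTIRectGSNode t U a b n lo`** — the rows of `LTIRectNode` PLUS the `S^z = 0` rows `Re Tr ρ N_σ = ab·n/2` PLUS
  the Bratteli–Robinson LOCAL-STABILITY rows `0 ≤ Tr ρ Γ(Ãᴴ [H_{Λ⁺}, Ã])` for every `Λ⁺ = thicken Λ 1 ⊆ W` and every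
  local `A ∈ 𝔄_Λ` commuting with the local `N` and `S^z` (the bootstrap's ground-state / "EOM–KKT" rows, efficiency
  lever L4; stationarity `Tr ρ Γ([H, Ã]) = 0` follows from the rows for `A + c·1`).  SOUNDNESS
  `LTIRectGSNode.le_energyDensity2D` (`a, b ≥ 2`, `0 ≤ n < 2`, `U ≥ 0`) on the torus-limit class (I) via the tree's
  `le_energyDensity2D_of_forall_torusLimit` + `IsTorusLimitOf.localStability`; cells `.m3EnergyLowerRow`,
  `.m2EnergyLowerRow`; `LTIRectNode.gsNode` (fewer rows ⇒ the §5 dominance edges feed this node as well).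
  REMARK (N-representability, lever L5): in this MARGINAL formulation `ρ` is a genuine window density matrix, so every
  k-RDM N-representability condition (P, Q, G, T1, T2) of the window is implied; such rows only add information in
  reduced (moment / 2-RDM-variable) formulations.

## What is NOT here (named gaps, for the filing / engine seats)

* **G-SYM-2D.** `tl_marginal2d`'s symmetry-identification rows (spin flip × D2 reflections × transpose on squares ×
  particle–hole at `n = 1`) and the `(N_↑, N_↓)`-sector block structure are NOT rows of `LTIRectNode` /
  `LTIRectGSNode`.  They are sound
  STRENGTHENINGS by a finite-dimensional averaging argument (group-average / `U(1)²`-twirl of a feasible `ρ` is feasible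
  with the same objective, because the group maps the LTI row family to itself and fixes `h_avg`, `N`), i.e. an edge
  `LTIRectSymNode → LTIRectNode` in the pattern of the 1-D `Rows/ChainMarginalSymNodes.lean`; not typed here.
* **G-ISO.** Isotropy rows (rotation invariance of `m × m` corner marginals of a NON-square window — the operative
  rows of op-08's `i2x3` canary, +0.086 at `U = 8`, `n = 7/8`) are not justified by in-window averaging.  Two sound
  routes, neither typed here: (i) a FINITE-TORUS marginal node — the window marginal of the TRACIAL sector ground
  state of the `L × L` torus is LTI, fully `D4`-invariant (`d4Affine_mul_hubbardTorus`, `d4Affine_mulVec_mem_szSector`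
  in `HubbardWindowCertificateD4.lean`), sector-block-diagonal and spin-flip invariant, with objective `E₀(L)/L²`;
  then `L → ∞` through the ground-energy-density limit, exactly as `energyDensity2D_ge_of_window_certificate_d4` does
  for identity certificates (this route discharges G-SYM-2D and G-ISO at once); (ii) a state-level point-group
  action on `InfVolFermionState 2` (absent from the tree; only `spinFlip` exists).  Until then certified runs should
  use the row set of `LTIRectGSNode` (or square windows with G-SYM-2D).
* STRICT improvement over Anderson is a numerical fact per instance (op-08's `tl_marginal2d` floats), not a theorem.

FILING NOTE (sr-mbsolver-lit-4 g9, 2026-08-22): the four modules `Rows/RectMarginalNodes.lean` → `…Anderson.lean` → `…Dominance.lean` → `…GS.lean`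
are sr-mbsolver-op-07 gen-11's PROVED HOME file `HOME/sr-mbsolver-op-07/lean/RectMarginalNodes.lean` (sha256 b7b18754ae1e5299…, 1 018 lines, 71 theorems +
15 defs, sorry-free; FILE REQUEST HOME INBOX l.4956, one-writer rule) split at its §3 / §5 / §6 headings to respect the gate's 400-line module
limit, with the working namespace `…CertifiedManyBodySolver.Sketch2D` renamed `Summit.Ventures.CertifiedManyBodySolver.Rows.RectMarginalNodes`; declarations,
statements and proofs are otherwise VERBATIM except two gate-driven edits: op-07's `sum_polySite_eq` is replaced by the landed
`Rows.AndersonDominatedByLTI.sum_ofLex_eq'` (dedup) and 22 one-line docstrings were added (lint.docstring). Contents by module: (1) §0 bookkeeping, §1 the TI dictionary (`bondEnergy` / `siteEnergy` / `densityC`, `expect_clusterHamiltonian`, `hubbardEnergyDensity_eq_re`), §2 `TIStateNode` + transport `TIStateNode.le_energyDensity2D`, tightness, cells `.m2EnergyLowerRow` / `.m3EnergyLowerRow`; (2) §3 the PROVED edge Anderson cluster floor ⇒ `TIStateNode` (`tiStateNode_of_andersonCluster_transposePair`, `tiStateNode_of_andersonRect`, instance `tiStateNode_of_rect2x4rot_opt_U8`)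 and §4 the matrix-level node `LTIRectNode` (`WindowLTI`, `hAvg`) with its PROVED soundness `LTIRectNode.tiStateNode` / `.m3EnergyLowerRow` / `.m2EnergyLowerRow`;
(3) §5 the window-LTI matrix dictionary (`wfun`, `WindowLTI.wfun_*`, `wBond` / `wSite` / `wDens`) and the DOMINANCE edge `ltiRectNode_of_andersonCluster_subset` (+ `_andersonRect_subset`, `_andersonCluster_transposePair_subset`, instance `ltiRectNode_of_rect2x4rot_opt_U8`); (4) §6 the ground-state-class node `LTIRectGSNode` (LTI + `S^z` + local-stability rows, `stabilityObs`) with its PROVED soundness `LTIRectGSNode.le_energyDensity2D` / cells and `LTIRectNode.gsNode`.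
-/

noncomputable section

open Matrix Complex Finset
open scoped ComplexOrder MatrixOrder BigOperators
open Literature.Probability.LatticeModels
open Literature.MathematicalPhysics.QuantumLattice
open Literature.MathematicalPhysics.QuantumLattice.AndersonCluster
open Literature.MathematicalPhysics.QuantumLattice.HubbardWave0
open Literature.MathematicalPhysics.QuantumLattice.ThermodynamicLimit

namespace Summit.Ventures.CertifiedManyBodySolver.Rows.RectMarginalNodes

/-! ## §0  Bookkeeping: sums over the ordered site set of a region = the landed
`Rows.AndersonDominatedByLTI.sum_ofLex_eq'` (`Σ_{y : PolySite Λ'} f (site y) = Σ_{x ∈ Λ'} f x`), reused by name (gate dedup). -/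

/-! ## §1  The term dictionary of a translation-invariant state on `ℤ²` -/

section Dictionary

variable (t U : ℝ)

/-- The bond energy `h_i(ω) = ω(Φ{0, e_i})` (`= -t ω(Σ_σ c†_0 c_{e_i} + h.c.)`) of a state in direction `i`. -/
def bondEnergy (ω : InfVolFermionState 2) (i : Fin 2) : ℂ :=
  ω.expect {0, 0 + unitVec i} ((hubbardFermionInteraction 2 t U).Φ {0, 0 + unitVec i})

/-- The on-site energy `u(ω) = ω(Φ{0}) = U ω(n_{0↑} n_{0↓})`. -/
def siteEnergy (ω : InfVolFermionState 2) : ℂ :=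
  ω.expect {0} ((hubbardFermionInteraction 2 t U).Φ {0})

/-- The complex density `ω(n_{0↑} + n_{0↓})` (its real part is `ω.density`). -/
def densityC (ω : InfVolFermionState 2) : ℂ :=
  ω.expect {0} (nAt 0 (mem_singleton_self 0) 0 + nAt 0 (mem_singleton_self 0) 1)

variable {t U}

/-- The density of `ω` is the real part of `densityC ω` (definitional). -/
theorem density_eq_re_densityC (ω : InfVolFermionState 2) : ω.density = (densityC ω).re := rfl

/-- `e(ω) = Re (u(ω) + h_0(ω) + h_1(ω))` for translation-invariant `ω`
(`IsTranslationInvariant.expect_hubbard_meanEnergyObs`). -/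
theorem hubbardEnergyDensity_eq_re {ω : InfVolFermionState 2} (hω : ω.IsTranslationInvariant) :
    ω.hubbardEnergyDensity t U = (siteEnergy t U ω + ∑ i : Fin 2, bondEnergy t U ω i).re := by
  rw [InfVolFermionState.hubbardEnergyDensity, InfVolFermionState.meanEnergy,
    hω.expect_hubbard_meanEnergyObs t U]
  rfl

variable {ω : InfVolFermionState 2} (hω : ω.IsTranslationInvariant) (R : Finset (Site 2))
include hω

/-- A window bond term has expectation the bond energy: `-t ω(T_{x,x+e_i}) = h_i(ω)` if the bond lies in
the window, `0` otherwise (open boundary conditions). -/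
theorem neg_t_mul_expect_clusterBondKinetic (y : PolySite R) (i : Fin 2) :
    -(t : ℂ) * ω.expect R (clusterBondKinetic R y i) =
      if ofLex y.1 + unitVec i ∈ R then bondEnergy t U ω i else 0 := by
  by_cases h : ofLex y.1 + unitVec i ∈ R
  · rw [if_pos h]
    have h2 : ({ofLex y.1, ofLex y.1 + unitVec i} : Finset (Site 2)) ⊆ R :=
      insert_subset (PolySite.ofLex_mem y) (singleton_subset_iff.2 h)
    have key : fermionEmbed (PolySite.incl h2)
        ((hubbardFermionInteraction 2 t U).Φ {ofLex y.1, ofLex y.1 + unitVec i}) =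
        -(t : ℂ) • clusterBondKinetic R y i := by
      rw [hubbardFermionInteraction_apply_pair, clusterBondKinetic, dif_pos h]
      simp only [map_smul, map_sum, map_add, map_mul, fermionEmbed_conjTranspose, fermionEmbed_incl_cAt]
      rfl
    rw [bondEnergy, ← hω.expect_hubbard_pair t U (ofLex y.1) i, ← ω.compatible h2, key, map_smul, smul_eq_mul]
  · rw [if_neg h, clusterBondKinetic, dif_neg h, map_zero, mul_zero]

/-- A window on-site term has expectation the on-site energy: `U ω(n_{x↑} n_{x↓}) = u(ω)`. -/
theorem U_mul_expect_numberOp_mul (y : PolySite R) :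
    (U : ℂ) * ω.expect R (numberOp y 0 * numberOp y 1) = siteEnergy t U ω := by
  have h1 : ({ofLex y.1} : Finset (Site 2)) ⊆ R := singleton_subset_iff.2 (PolySite.ofLex_mem y)
  have key : fermionEmbed (PolySite.incl h1) ((hubbardFermionInteraction 2 t U).Φ {ofLex y.1}) =
      (U : ℂ) • (numberOp y 0 * numberOp y 1) := by
    rw [hubbardFermionInteraction_apply_singleton]
    simp only [map_smul, map_mul, nAt, fermionEmbed_numberOp, PolySite.incl_pt]
    rfl
  rw [siteEnergy, ← hω.expect_hubbard_singleton t U (ofLex y.1), ← ω.compatible h1, key, map_smul, smul_eq_mul]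

/-- A window density term has expectation the density: `ω(n_{x↑} + n_{x↓}) = ω(n_{0↑} + n_{0↓})`. -/
theorem expect_numberOp_add (y : PolySite R) :
    ω.expect R (numberOp y 0 + numberOp y 1) = densityC ω := by
  have h1 : ({ofLex y.1} : Finset (Site 2)) ⊆ R := singleton_subset_iff.2 (PolySite.ofLex_mem y)
  have key : fermionEmbed (PolySite.incl h1)
      (nAt (ofLex y.1) (mem_singleton_self _) 0 + nAt (ofLex y.1) (mem_singleton_self _) 1) =
      numberOp y 0 + numberOp y 1 := by
    simp only [map_add, nAt, fermionEmbed_numberOp, PolySite.incl_pt]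
    rfl
  rw [← key, ω.compatible h1, map_add, hω.expect_nAt (ofLex y.1) 0, hω.expect_nAt (ofLex y.1) 1, densityC,
    map_add]

/-- **The expectation of a weighted open-cluster Hamiltonian in a translation-invariant state** is read off the
weight sums: `ω(h(J,V,μ)) = Σ_i (Σ bonds_i J) h_i + (Σ V) u + (Σ μ) ω(n_0)`. -/
theorem expect_clusterHamiltonian (J : Site 2 → Fin 2 → ℝ) (V μ : Site 2 → ℝ) :
    ω.expect R (clusterHamiltonian R t U J V μ) =
      ∑ i : Fin 2, ((bondWeightSum R J i : ℝ) : ℂ) * bondEnergy t U ω i +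
        ((siteWeightSum R V : ℝ) : ℂ) * siteEnergy t U ω + ((siteWeightSum R μ : ℝ) : ℂ) * densityC ω := by
  have hA' : ∀ (y : PolySite R) (i : Fin 2),
      -(t : ℂ) * (((J (ofLex y.1) i : ℝ) : ℂ) * ω.expect R (clusterBondKinetic R y i)) =
        ((bondWeight R J (ofLex y.1) i : ℝ) : ℂ) * bondEnergy t U ω i := by
    intro y i
    rw [mul_left_comm, neg_t_mul_expect_clusterBondKinetic (U := U) hω R y i]
    unfold AndersonCluster.bondWeight
    split_ifs <;> simp
  have hA : ω.expect R (-(t : ℂ) • ∑ y : PolySite R, ∑ i : Fin 2,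
      ((J (ofLex y.1) i : ℝ) : ℂ) • clusterBondKinetic R y i) =
      ∑ i : Fin 2, ((bondWeightSum R J i : ℝ) : ℂ) * bondEnergy t U ω i := by
    simp only [map_smul, map_sum, smul_eq_mul, Finset.mul_sum, hA']
    rw [Finset.sum_comm]
    refine Finset.sum_congr rfl fun i _ => ?_
    rw [← Finset.sum_mul, AndersonCluster.bondWeightSum, ← AndersonDominatedByLTI.sum_ofLex_eq' R (fun x => bondWeight R J x i),
      Complex.ofReal_sum]
  have hB : ω.expect R ((U : ℂ) • ∑ y : PolySite R,
      ((V (ofLex y.1) : ℝ) : ℂ) • (numberOp y 0 * numberOp y 1)) =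
      ((siteWeightSum R V : ℝ) : ℂ) * siteEnergy t U ω := by
    simp only [map_smul, map_sum, smul_eq_mul, Finset.mul_sum]
    have : ∀ y : PolySite R, (U : ℂ) * (((V (ofLex y.1) : ℝ) : ℂ) * ω.expect R (numberOp y 0 * numberOp y 1)) =
        ((V (ofLex y.1) : ℝ) : ℂ) * siteEnergy t U ω := fun y => by
      rw [mul_left_comm, U_mul_expect_numberOp_mul (t := t) hω R y]
    simp only [this]
    rw [← Finset.sum_mul, AndersonCluster.siteWeightSum, ← AndersonDominatedByLTI.sum_ofLex_eq' R V, Complex.ofReal_sum]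
  have hC : ω.expect R (∑ y : PolySite R, ((μ (ofLex y.1) : ℝ) : ℂ) • (numberOp y 0 + numberOp y 1)) =
      ((siteWeightSum R μ : ℝ) : ℂ) * densityC ω := by
    simp only [map_sum, map_smul, smul_eq_mul, expect_numberOp_add hω R]
    rw [← Finset.sum_mul, AndersonCluster.siteWeightSum, ← AndersonDominatedByLTI.sum_ofLex_eq' R μ, Complex.ofReal_sum]
  rw [clusterHamiltonian, map_add, map_add, hA, hB, hC]

end Dictionary

/-! ## §2  The translation-invariant-state node `TIStateNode` and its transport to `energyDensity2D` -/

/-- **The TI-state node** `TIStateNode t U n lo`: every translation-invariant, even state `ω` of the lattice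
fermion algebra over `ℤ² × {↑,↓}` with particle density `ω(n_0) = n` has Hubbard energy density
`ω(Φ{0}) + Σ_i ω(Φ{0,e_i}) ≥ lo`.  This is the common TARGET of every thermodynamic-limit lower-bound method of the
programme (Anderson clusters, LTI window marginals, moment relaxations): each of them proves `TIStateNode` for its
constant, and `TIStateNode.le_energyDensity2D` is the ONE transport to the audited TL energy. -/
def TIStateNode (t U n lo : ℝ) : Prop :=
  ∀ ω : InfVolFermionState 2, ω.IsTranslationInvariant → ω.IsEven → ω.density = n → lo ≤ ω.hubbardEnergyDensity t U

/-- `TIStateNode` is monotone in the slot: a smaller constant is also a valid floor. -/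
theorem TIStateNode.mono {t U n lo lo' : ℝ} (h : TIStateNode t U n lo) (hlo : lo' ≤ lo) : TIStateNode t U n lo' :=
  fun ω hti hev hd => hlo.trans (h ω hti hev hd)

/-- **Transport (soundness of the node).** `TIStateNode t U n lo → lo ≤ e(t,U,n)` for `0 ≤ n < 2`, `U ≥ 0`: the
canonical ground states of the `L × L` tori have translation-invariant, even torus-limit states of density `n` and
energy density `e(t,U,n)` (`le_energyDensity2D_of_forall_isTranslationInvariant`). -/
theorem TIStateNode.le_energyDensity2D {t U n lo : ℝ} (h : TIStateNode t U n lo) (hU : 0 ≤ U) (hn0 : 0 ≤ n)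
    (hn2 : n < 2) : lo ≤ energyDensity2D t U n :=
  le_energyDensity2D_of_forall_isTranslationInvariant t hU hn0 hn2 fun ω hti hev hd => h ω hti hev hd

/-- **The node is tight**: it holds with `lo = e(t,U,n)` itself (Gibbs variational principle,
`IsTranslationInvariant.energyDensity2D_le_hubbardEnergyDensity`), so `sup {lo : TIStateNode t U n lo} = e(t,U,n)`
for `0 < n < 2`: a COMPLETE hierarchy of relaxations of `TIStateNode` converges to the TL energy. -/
theorem tiStateNode_energyDensity2D (t : ℝ) {U : ℝ} (hU : 0 ≤ U) {n : ℝ} (hn0 : 0 < n) (hn2 : n < 2) :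
    TIStateNode t U n (energyDensity2D t U n) := fun ω hti _ hd => by
  subst hd
  exact hti.energyDensity2D_le_hubbardEnergyDensity t hU hn0 hn2

/-- **Cell M2** (half filling, `t = 1`): `TIStateNode 1 U 1 lo → M2EnergyLowerRow U lo`. -/
theorem TIStateNode.m2EnergyLowerRow {U : ℝ} {lo : ℚ} (h : TIStateNode 1 U 1 lo) (hU : 0 ≤ U) :
    M2EnergyLowerRow U lo :=
  h.le_energyDensity2D hU zero_le_one one_lt_two

/-- **Cell M3 at `t' = 0`** (the programme's TARGET OF RECORD `U = 8`, `n = 7/8`):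
`TIStateNode 1 8 (7/8) lo → M3EnergyLowerRow 0 lo`. -/
theorem TIStateNode.m3EnergyLowerRow {lo : ℚ} (h : TIStateNode 1 8 (7 / 8) lo) : M3EnergyLowerRow 0 lo :=
  (M3EnergyLowerRow_zero_iff lo).2 (h.le_energyDensity2D (by norm_num) (by norm_num) (by norm_num))

end Summit.Ventures.CertifiedManyBodySolver.Rows.RectMarginalNodes

end
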